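import Summits.CriticalPhenomena.PercolationContinuityZ3.Theorems.PercNearOneGluingNoHeavyLowerTailSahiCombTriWHalfChainHall

/-!
# The GENERAL `a = 2` netted token system (both middle pairs arbitrary diamonds): the exact identity and the typed Hall target `DiamondHall`

Support file of the one-cut programme (crux `NoHeavyLowerTail`, stmt-CriticalPhenomena-4575; cell `prim-masterthm`, seat P5 gen 29;
memo `FROM-prim-masterthm-p5-g29-HALFCHAIN-PROOF.md` §4–§5).  Companion of `…SahiCombTriWHalfChainHall` (P5 gen 28, the half-chain case `Gp ⊆ Gq`, PROVED by this seat in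
`…TriWHalfChainKernel` / `…TriWHalfChainHallProof`).  Here the `G`-middles `Gp = G{a}`, `Gq = G{b}` are NOT assumed comparable: the reflected terms then net into
THREE shell demands — the two double-crossing cells `refl((Fq\\Fp)(Gq\\Gp))`, `refl((Fp\\Fq)(Gp\\Gq))` (gen 28 merged them as "aligned"; splitting them is what makes 0/1 visibility designs
exist, memo §4) and the netted outer shell `refl Σ'`, `Σ' = (F₁\\F₀)(G₁\\G₀) \\ ((Fp\\Fq)(Gq\\Gp) ∪ (Fq\\Fp)(Gp\\Gq))` (outer shell minus the two anti-crossing cells).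

* **`FiveUpSet.inner_pair_eq_diamond`** — the EXACT identity for arbitrary diamonds `F₀ ⊆ Fp, Fq ⊆ F₁`, `G₀ ⊆ Gp, Gq ⊆ G₁` (pointwise `decide` on the `6⁴` patterns):
  `triWOne(P;F₀,F₁;G₀,G₁) + triWOne(P;Fp,Fq;Gp,Gq) = halfChainSupply − diamondDemand` (the supplies are the half-chain ones: `S, U, M, N` twice);
* **`FiveUpSet.DiamondHall`** (`@[conjecture]`, OURS — an obligation of the theory, never a fact; ⟺ `TriWIneq` at `a = 2` by the identity and `triW_nonneg_of_pair_nonneg`):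
  `diamondDemand ≤ halfChainSupply` inside every up-set `P`.  EVIDENCE (P5 gen 29): its RANK form has 0/1 visibility designs of full row rank on ALL 28,224 + 57,471,561 pairs of
  diamonds on `2²`, `2³` and thousands of random pairs on `2⁴…2⁶` (design D5: `a:{S_a,S_b} b:{S_a,N_b} c:{S_b,U_a,N_a} d:{S_a,S_b,U_a} e:{S_b,M_a} f:{S_a,U_b,M_b,N_a} g:{S_a,U_a,M_b}
  h:{S_b,M_a,N_b} i₁:{N_b} i₂:{S_a,M_b} j:{S_a,S_b}`), none of which the type-level prover `cprove2` proves (memo §4b, §5).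
* **`FiveUpSet.inner_pair_le_of_diamondHall`**, **`FiveUpSet.triW_nonneg_two_of_diamondHall`** — the reduction `DiamondHall ⟹ 0 ≤ triW` for EVERY pair of monotone
  families over a two-atom index cube (no comparability hypothesis): with `triW_nonneg_two_of_one_comparable` (this seat) only the doubly-incomparable instances of `DiamondHall` are still needed.
HONEST LABEL: an exact identity, a typed conjecture (the whole of `TriWIneq` at `a = 2`) and its reduction; no new unconditional stratum in this file. [this work]
-/

namespace Summit.CriticalPhenomena.PercolationContinuityZ3.Theorems

namespace FiveUpSet

open Finset LatticeFiveUpSet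

variable {γ : Type} [DecidableEq γ] [Fintype γ]

/-- GENERAL `a = 2` demand count inside `P` (eleven classes: eight crossed pairs, the two double-crossing cells, the netted outer shell). [this work] -/
def diamondDemand (P F₀ Fp Fq F₁ G₀ Gp Gq G₁ : Finset (Finset γ)) : ℕ :=
  (P ∩ refl F₀ ∩ G₁).card + (P ∩ F₀ ∩ refl G₁).card + (P ∩ refl F₁ ∩ G₀).card + (P ∩ F₁ ∩ refl G₀).card
    + (P ∩ refl Fp ∩ Gq).card + (P ∩ Fp ∩ refl Gq).card + (P ∩ refl Fq ∩ Gp).card + (P ∩ Fq ∩ refl Gp).card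
    + (P ∩ refl ((Fq \ Fp) ∩ (Gq \ Gp))).card + (P ∩ refl ((Fp \ Fq) ∩ (Gp \ Gq))).card
    + (P ∩ refl (((F₁ \ F₀) ∩ (G₁ \ G₀)) \ ((Fp \ Fq) ∩ (Gq \ Gp) ∪ (Fq \ Fp) ∩ (Gp \ Gq)))).card

/-- **DIAMOND HALL** (CONJECTURE — an obligation of our theory, never a fact): for up-sets `P`, `F₀ ⊆ Fp, Fq ⊆ F₁`, `G₀ ⊆ Gp, Gq ⊆ G₁` of a finite cube,
`diamondDemand ≤ halfChainSupply`.  Equivalent to `TriWIneq` at `a = 2` (`inner_pair_eq_diamond` + `triW_nonneg_of_pair_nonneg`); the comparable-middle instances are theorems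
(`halfChainHall_holds`, `triW_nonneg_two_of_one_comparable`). [this work] -/
@[conjecture] def DiamondHall : Prop :=
  ∀ (γ : Type) [DecidableEq γ] [Fintype γ] (P F₀ Fp Fq F₁ G₀ Gp Gq G₁ : Finset (Finset γ)),
    IsUpperSet (P : Set (Finset γ)) → IsUpperSet (F₀ : Set (Finset γ)) → IsUpperSet (Fp : Set (Finset γ)) → IsUpperSet (Fq : Set (Finset γ)) →
    IsUpperSet (F₁ : Set (Finset γ)) → IsUpperSet (G₀ : Set (Finset γ)) → IsUpperSet (Gp : Set (Finset γ)) → IsUpperSet (Gq : Set (Finset γ)) →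
    IsUpperSet (G₁ : Set (Finset γ)) →
    F₀ ⊆ Fp → F₀ ⊆ Fq → Fp ⊆ F₁ → Fq ⊆ F₁ → G₀ ⊆ Gp → G₀ ⊆ Gq → Gp ⊆ G₁ → Gq ⊆ G₁ →
    diamondDemand P F₀ Fp Fq F₁ G₀ Gp Gq G₁ ≤ halfChainSupply P F₀ Fp Fq F₁ G₀ Gp Gq G₁

set_option synthInstance.maxHeartbeats 400000 in
set_option synthInstance.maxSize 4096 in
set_option maxHeartbeats 1600000 in
/-- **The exact token identity for two ARBITRARY diamonds** (only the eight diamond inclusions are used):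
`triWOne(P;F₀,F₁;G₀,G₁) + triWOne(P;Fp,Fq;Gp,Gq) = halfChainSupply − diamondDemand`. [this work] -/
theorem inner_pair_eq_diamond (P F₀ Fp Fq F₁ G₀ Gp Gq G₁ : Finset (Finset γ))
    (hF0p : F₀ ⊆ Fp) (hF0q : F₀ ⊆ Fq) (hFp1 : Fp ⊆ F₁) (hFq1 : Fq ⊆ F₁) (hG0p : G₀ ⊆ Gp) (hG0q : G₀ ⊆ Gq) (hGp1 : Gp ⊆ G₁) (hGq1 : Gq ⊆ G₁) :
    triWOne (complEquiv γ) P F₀ F₁ G₀ G₁ + triWOne (complEquiv γ) P Fp Fq Gp Gq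
      = (halfChainSupply P F₀ Fp Fq F₁ G₀ Gp Gq G₁ : ℤ) - (diamondDemand P F₀ Fp Fq F₁ G₀ Gp Gq G₁ : ℤ) := by
  rw [triWOne_expand, triWOne_expand]
  unfold halfChainSupply diamondDemand
  push_cast
  have h1 : 0 ≤ 1 * ((2 * (((P ∩ F₀ ∩ G₀).card : ℤ) + ((P ∩ F₁ ∩ G₁).card : ℤ)) - (((P ∩ refl F₀ ∩ G₁).card : ℤ) + ((P ∩ refl F₁ ∩ G₀).card : ℤ)) - (((P ∩ F₀ ∩ refl G₁).card : ℤ) + ((P ∩ F₁ ∩ refl G₀).card : ℤ)) - (((P ∩ refl F₀ ∩ refl G₀).card : ℤ) + ((P ∩ refl F₁ ∩ refl G₁).card : ℤ)) + (((P ∩ refl F₀ ∩ refl G₁).card : ℤ) + ((P ∩ refl F₁ ∩ refl G₀).card : ℤ))) + (2 * (((P ∩ Fp ∩ Gp).card : ℤ) + ((P ∩ Fq ∩ Gq).card : ℤ)) - (((P ∩ refl Fp ∩ Gq).card : ℤ) + ((P ∩ refl Fq ∩ Gp).card : ℤ)) - (((P ∩ Fp ∩ refl Gq).card : ℤ) +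 ((P ∩ Fq ∩ refl Gp).card : ℤ)) - (((P ∩ refl Fp ∩ refl Gp).card : ℤ) + ((P ∩ refl Fq ∩ refl Gq).card : ℤ)) + (((P ∩ refl Fp ∩ refl Gq).card : ℤ) + ((P ∩ refl Fq ∩ refl Gp).card : ℤ)))) - (1 * (2 * ((P ∩ F₁ ∩ G₁).card : ℤ) + 2 * ((P ∩ F₀ ∩ G₀).card : ℤ) + 2 * ((P ∩ Fp ∩ Gp).card : ℤ) + 2 * ((P ∩ Fq ∩ Gq).card : ℤ)) - 1 * (((P ∩ refl F₀ ∩ G₁).card : ℤ) + ((P ∩ F₀ ∩ refl G₁).card : ℤ) + ((P ∩ refl F₁ ∩ G₀).card : ℤ) + ((P ∩ F₁ ∩ refl G₀).card : ℤ) + ((P ∩ refl Fp ∩ Gq).card : ℤ) + ((P ∩ Fp ∩ refl Gq).card : ℤ) + ((P ∩ refl Fq ∩ Gp).card : ℤ) + ((P ∩ Fq ∩ refl Gp).card : ℤ) + ((P ∩ refl ((Fq \ Fp) ∩ (Gq \ Gp))).card : ℤ) + ((P ∩ refl ((Fp \ Fq) ∩ (Gp \ Gq))).card : ℤ) + ((P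 ∩ refl (((F₁ \ F₀) ∩ (G₁ \ G₀)) \ ((Fp \ Fq) ∩ (Gq \ Gp) ∪ (Fq \ Fp) ∩ (Gp \ Gq)))).card : ℤ))) := by
    simp only [card_eq_univ_sum]
    simp only [mem_inter, mem_refl, mem_sdiff, mem_union]
    simp only [mul_add, mul_sub]
    simp only [Finset.mul_sum, ← Finset.sum_add_distrib, ← Finset.sum_sub_distrib]
    refine Finset.sum_nonneg (fun w _ => ?_)
    obtain ⟨s₁, a0, ap, aq, a1⟩ := diamond_pos hF0p hF0q hFp1 hFq1 w
    obtain ⟨s₂, b0, bp, bq, b1⟩ := diamond_pos hG0p hG0q hGp1 hGq1 w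
    obtain ⟨s₃, c0, cp, cq, c1⟩ := diamond_pos hF0p hF0q hFp1 hFq1 wᶜ
    obtain ⟨s₄, d0, dp, dq, d1⟩ := diamond_pos hG0p hG0q hGp1 hGq1 wᶜ
    simp only [a0, ap, aq, a1, b0, bp, bq, b1, c0, cp, cq, c1, d0, dp, dq, d1]
    clear a0 ap aq a1 b0 bp bq b1 c0 cp cq c1 d0 dp dq d1
    by_cases hp : w ∈ P <;> simp only [hp] <;> (revert s₁ s₂ s₃ s₄; decide)
  have h2 : 0 ≤ (1 * (2 * ((P ∩ F₁ ∩ G₁).card : ℤ) + 2 * ((P ∩ F₀ ∩ G₀).card : ℤ) + 2 * ((P ∩ Fp ∩ Gp).card : ℤ) + 2 * ((P ∩ Fq ∩ Gq).card : ℤ)) - 1 * (((P ∩ refl F₀ ∩ G₁).card : ℤ) + ((P ∩ F₀ ∩ refl G₁).card : ℤ) + ((P ∩ refl F₁ ∩ G₀).card : ℤ) + ((P ∩ F₁ ∩ refl G₀).card : ℤ) + ((P ∩ refl Fp ∩ Gq).card : ℤ) + ((P ∩ Fp ∩ refl Gq).card : ℤ) + ((P ∩ refl Fq ∩ Gp).card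 : ℤ) + ((P ∩ Fq ∩ refl Gp).card : ℤ) + ((P ∩ refl ((Fq \ Fp) ∩ (Gq \ Gp))).card : ℤ) + ((P ∩ refl ((Fp \ Fq) ∩ (Gp \ Gq))).card : ℤ) + ((P ∩ refl (((F₁ \ F₀) ∩ (G₁ \ G₀)) \ ((Fp \ Fq) ∩ (Gq \ Gp) ∪ (Fq \ Fp) ∩ (Gp \ Gq)))).card : ℤ))) - 1 * ((2 * (((P ∩ F₀ ∩ G₀).card : ℤ) + ((P ∩ F₁ ∩ G₁).card : ℤ)) - (((P ∩ refl F₀ ∩ G₁).card : ℤ) + ((P ∩ refl F₁ ∩ G₀).card : ℤ)) - (((P ∩ F₀ ∩ refl G₁).card : ℤ) + ((P ∩ F₁ ∩ refl G₀).card : ℤ)) - (((P ∩ refl F₀ ∩ refl G₀).card : ℤ) + ((P ∩ refl F₁ ∩ refl G₁).card : ℤ)) + (((P ∩ refl F₀ ∩ refl G₁).card : ℤ) + ((P ∩ refl F₁ ∩ refl G₀).card : ℤ))) + (2 * (((P ∩ Fp ∩ Gp).card : ℤ) + ((P ∩ Fq ∩ Gq).card : ℤ)) - (((P ∩ refl Fp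 ∩ Gq).card : ℤ) + ((P ∩ refl Fq ∩ Gp).card : ℤ)) - (((P ∩ Fp ∩ refl Gq).card : ℤ) + ((P ∩ Fq ∩ refl Gp).card : ℤ)) - (((P ∩ refl Fp ∩ refl Gp).card : ℤ) + ((P ∩ refl Fq ∩ refl Gq).card : ℤ)) + (((P ∩ refl Fp ∩ refl Gq).card : ℤ) + ((P ∩ refl Fq ∩ refl Gp).card : ℤ)))) := by
    simp only [card_eq_univ_sum]
    simp only [mem_inter, mem_refl, mem_sdiff, mem_union]
    simp only [mul_add, mul_sub]
    simp only [Finset.mul_sum, ← Finset.sum_add_distrib, ← Finset.sum_sub_distrib]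
    refine Finset.sum_nonneg (fun w _ => ?_)
    obtain ⟨s₁, a0, ap, aq, a1⟩ := diamond_pos hF0p hF0q hFp1 hFq1 w
    obtain ⟨s₂, b0, bp, bq, b1⟩ := diamond_pos hG0p hG0q hGp1 hGq1 w
    obtain ⟨s₃, c0, cp, cq, c1⟩ := diamond_pos hF0p hF0q hFp1 hFq1 wᶜ
    obtain ⟨s₄, d0, dp, dq, d1⟩ := diamond_pos hG0p hG0q hGp1 hGq1 wᶜ
    simp only [a0, ap, aq, a1, b0, bp, bq, b1, c0, cp, cq, c1, d0, dp, dq, d1]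
    clear a0 ap aq a1 b0 bp bq b1 c0 cp cq c1 d0 dp dq d1
    by_cases hp : w ∈ P <;> simp only [hp] <;> (revert s₁ s₂ s₃ s₄; decide)
  linarith [h1, h2]

/-- **DIAMOND HALL ⟹ the pair sum is non-negative** for arbitrary diamonds. [this work] -/
theorem inner_pair_le_of_diamondHall (h : DiamondHall) (P F₀ Fp Fq F₁ G₀ Gp Gq G₁ : Finset (Finset γ)) (hP : IsUpperSet (P : Set (Finset γ)))
    (hF₀ : IsUpperSet (F₀ : Set (Finset γ))) (hFp : IsUpperSet (Fp : Set (Finset γ))) (hFq : IsUpperSet (Fq : Set (Finset γ)))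
    (hF₁ : IsUpperSet (F₁ : Set (Finset γ))) (hG₀ : IsUpperSet (G₀ : Set (Finset γ))) (hGp : IsUpperSet (Gp : Set (Finset γ)))
    (hGq : IsUpperSet (Gq : Set (Finset γ))) (hG₁ : IsUpperSet (G₁ : Set (Finset γ)))
    (hF0p : F₀ ⊆ Fp) (hF0q : F₀ ⊆ Fq) (hFp1 : Fp ⊆ F₁) (hFq1 : Fq ⊆ F₁) (hG0p : G₀ ⊆ Gp) (hG0q : G₀ ⊆ Gq) (hGp1 : Gp ⊆ G₁) (hGq1 : Gq ⊆ G₁) :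
    0 ≤ triWOne (complEquiv γ) P F₀ F₁ G₀ G₁ + triWOne (complEquiv γ) P Fp Fq Gp Gq := by
  rw [inner_pair_eq_diamond P F₀ Fp Fq F₁ G₀ Gp Gq G₁ hF0p hF0q hFp1 hFq1 hG0p hG0q hGp1 hGq1]
  have := h γ P F₀ Fp Fq F₁ G₀ Gp Gq G₁ hP hF₀ hFp hFq hF₁ hG₀ hGp hGq hG₁ hF0p hF0q hFp1 hFq1 hG0p hG0q hGp1 hGq1
  omega

/-- **DIAMOND HALL ⟹ `TRI_W(2) ≥ 0` for EVERY pair of monotone families of up-sets** over a two-atom index cube `univ = {a, b}` (no comparability hypothesis). [this work] -/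
theorem triW_nonneg_two_of_diamondHall (h : DiamondHall) {β : Type} [DecidableEq β] [Fintype β] {a b : β} (hab : a ≠ b)
    (hu : (univ : Finset β) = {a, b}) (P : Finset (Finset γ)) (F G : Finset β → Finset (Finset γ))
    (hP : IsUpperSet (P : Set (Finset γ))) (hF : ∀ x, IsUpperSet (F x : Set (Finset γ))) (hG : ∀ x, IsUpperSet (G x : Set (Finset γ)))
    (hFm : Monotone F) (hGm : Monotone G) : 0 ≤ triW P F G := by
  refine LatticeFiveUpSet.triW_nonneg_of_pair_nonneg hab hu P F G ?_
  exact inner_pair_le_of_diamondHall h P (F ∅) (F {a}) (F {b}) (F univ) (G ∅) (G {a}) (G {b}) (G univ) hP (hF ∅) (hF {a}) (hF {b}) (hF univ)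
    (hG ∅) (hG {a}) (hG {b}) (hG univ) (hFm (empty_subset _)) (hFm (empty_subset _)) (hFm (subset_univ _)) (hFm (subset_univ _))
    (hGm (empty_subset _)) (hGm (empty_subset _)) (hGm (subset_univ _)) (hGm (subset_univ _))

end FiveUpSet

end Summit.CriticalPhenomena.PercolationContinuityZ3.Theorems
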